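import Literature.NumberTheory.LFunctions.KowalskiMichelPeterssonBoundWeilFree
import Literature.NumberTheory.LFunctions.KowalskiMichelPeterssonNewformExpansion
import Literature.NumberTheory.ModularForms.PoincareSeriesWeightTwoHecke
import Literature.NumberTheory.ModularForms.PoincareSeriesWeightTwoHeckeConvergence
import Literature.NumberTheory.ModularForms.PoincareSeriesWeightTwoFourierModes
import Literature.NumberTheory.ModularForms.PoincareSeriesWeightTwoHeckeLimit
import Literature.NumberTheory.ModularForms.PoincareSeriesWeightTwoHeckeUnfolding
import Literature.NumberTheory.ModularForms.PoincareSeriesWeightTwoCuspFormOfL2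
import Literature.NumberTheory.ModularForms.PoincareSeriesWeightTwoHeckeAssembly
import HarnessLib

/-!
# Kowalski–Michel 2000 — Petersson's formula at prime level, weight 2, REDUCED to the `L²` step

The printed Petersson formula `kowalskiMichel2000_peterssonFormula` ([KM00, §2.4.2 p. 312]) is proved here
from ONE remaining analytic input, the `L²`-convergence step of Hecke's trick for the weight-2 Poincaré
series (Iwaniec–Kowalski, *Analytic Number Theory*, §14.2, remark after (14.13), at `k = 2`):

* `hT4` : for every level `N ≥ 1` and `m ≥ 1`, the printed `q`-series `poincareQSeries N m` and the Hecke
  series `y ^ s · poincareHecke N m s` are Petersson-square-integrable on the `Γ₀(N)`-tiled fundamental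
  domain, and `‖y ^ s P_m(·, s) − Q_m‖²_{Pet} → 0` as `s → 0⁺`.

Everything else — absolute convergence and automorphy of the Hecke series (`heckeConvergence`), its Fourier
modes (`heckeFourierModes`) and their `s → 0⁺` limit (`heckeLimit_of_fourierModes`), Rankin–Selberg
unfolding (`heckeUnfolding`), the `L²`-limit-is-a-cusp-form step (`cuspFormOfL2`), the assembly
(`poincareAssembly`) and the prime-level newform Parseval step (`cuspCoeff_eq_mul_pet_of_peterssonProduct_eq`)
— is already kernel-checked in the imported files; this file is the bookkeeping that turns a proof of `hT4`
into `kowalskiMichel2000_peterssonFormula` (and hence, via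
`KowalskiMichelPeterssonBoundWeilFree.peterssonBoundPrinted_of_peterssonFormula`, into the printed
Petersson-type bound).
-/

noncomputable section

open scoped MatrixGroups Real Topology
open CongruenceSubgroup Complex MeasureTheory Filter
open UpperHalfPlane hiding I
open Literature.NumberTheory.EllipticCurves.ModularForms
open Literature.NumberTheory.ModularForms.PoincareWeightTwo

namespace Literature.NumberTheory.LFunctions.KowalskiMichel2000

/-- **The weight-2 Poincaré cusp form of level `N`: printed coefficients and reproducing property, modulo
the `L²` step.** For every `N ≥ 1` and `m ≥ 1` there is `P ∈ S₂(Γ₀(N))` with `n`-th coefficient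
`δ(m,n) − √(n/m)·J_N(m,n)` (`poincareCoeff`) and `⟨P, f⟩ = a_f(m)/(4πm)` for all `f ∈ S₂(Γ₀(N))`
(Iwaniec–Kowalski, Lemmas 14.2–14.3 at `k = 2` via Hecke's trick), assembled from the kernel-checked pieces
by `poincareAssembly`, given the `L²`-convergence hypothesis `hT4`.
[cite: IwaniecKowalski2004, Lemma 14.2, Lemma 14.3 and the remark after (14.13), k = 2] -/
theorem poincareExists_of_heckeL2
    (hT4 : ∀ (N : ℕ) [NeZero N] (m : ℕ), 1 ≤ m →
      PeterssonSqIntegrable N 2 (poincareQSeries N m) ∧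
      (∀ s : ℝ, 0 < s →
        PeterssonSqIntegrable N 2 (fun z : ℍ ↦ ((z.im ^ s : ℝ) : ℂ) * poincareHecke N m s z)) ∧
      Tendsto (fun s : ℝ ↦ (peterssonPairing N 2
          (fun z : ℍ ↦ ((z.im ^ s : ℝ) : ℂ) * poincareHecke N m s z - poincareQSeries N m z)
          (fun z : ℍ ↦ ((z.im ^ s : ℝ) : ℂ) * poincareHecke N m s z - poincareQSeries N m z)).re)
        (𝓝[>] 0) (𝓝 0)) :
    ∀ (N : ℕ) [NeZero N] (m : ℕ), 1 ≤ m → ∃ P : CuspForm (Gamma0 N) 2,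
      (∀ n : ℕ, 1 ≤ n → cuspCoeff P n = poincareCoeff N m n) ∧
      (∀ f : CuspForm (Gamma0 N) 2,
        peterssonProduct (Gamma0 N) 2 P f = ((1 / (4 * π * m) : ℝ) : ℂ) * cuspCoeff f m) :=
  poincareAssembly heckeConvergence (heckeLimit_of_fourierModes heckeFourierModes) heckeUnfolding hT4
    cuspFormOfL2

/-- **Kowalski–Michel 2000, §2.4.2 p. 312 — Petersson's formula at prime level and weight 2, modulo the
`L²` step `hT4`.** From the Poincaré series `P = P_{l₁}` of `poincareExists_of_heckeL2` at prime level `q`: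
the newform Parseval step gives `√(l₂/l₁)·Δ_q(l₁,l₂) = 4π√(l₁l₂)·⟨P,P⟩⁻¹… = a_P(l₂)` in the printed
normalisation (`cuspCoeff_eq_mul_pet_of_peterssonProduct_eq` with `c = 1/(4πl₁)`), while the coefficient
formula gives `a_P(l₂) = δ(l₁,l₂) − √(l₂/l₁)·J_q(l₁,l₂)`; dividing by `√(l₂/l₁) > 0` is the printed identity
`Δ_q(l₁,l₂) = δ(l₁,l₂) − J_q(l₁,l₂)` (the summability half is `peterssonFormula_iff_identity`).
[cite: KowalskiMichel2000, §2.4.2 p. 312 (Petersson's formula)] -/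
theorem peterssonFormula_of_heckeL2
    (hT4 : ∀ (N : ℕ) [NeZero N] (m : ℕ), 1 ≤ m →
      PeterssonSqIntegrable N 2 (poincareQSeries N m) ∧
      (∀ s : ℝ, 0 < s →
        PeterssonSqIntegrable N 2 (fun z : ℍ ↦ ((z.im ^ s : ℝ) : ℂ) * poincareHecke N m s z)) ∧
      Tendsto (fun s : ℝ ↦ (peterssonPairing N 2
          (fun z : ℍ ↦ ((z.im ^ s : ℝ) : ℂ) * poincareHecke N m s z - poincareQSeries N m z)
          (fun z : ℍ ↦ ((z.im ^ s : ℝ) : ℂ) * poincareHecke N m s z - poincareQSeries N m z)).re)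
        (𝓝[>] 0) (𝓝 0)) :
    kowalskiMichel2000_peterssonFormula := by
  rw [peterssonFormula_iff_identity]
  intro q _ hq l₁ l₂ h₁' h₂'
  obtain ⟨P, hP, hrep⟩ := poincareExists_of_heckeL2 hT4 q l₁ h₁'
  have hA := cuspCoeff_eq_mul_pet_of_peterssonProduct_eq hq h₁' h₂' P (1 / (4 * π * l₁)) hrep
  have hB := hP l₂ h₂'
  rw [poincareCoeff] at hB
  have hl₁ : (0 : ℝ) < l₁ := by exact_mod_cast h₁'
  have hl₂ : (0 : ℝ) < l₂ := by exact_mod_cast h₂'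
  have hρ : 1 / (4 * π * (l₁ : ℝ)) * (4 * π * Real.sqrt ((l₁ : ℝ) * l₂)) =
      Real.sqrt l₂ / Real.sqrt l₁ := by
    rw [Real.sqrt_mul hl₁.le]
    have h1 : Real.sqrt (l₁ : ℝ) ≠ 0 := (Real.sqrt_pos.mpr hl₁).ne'
    have h1' : (Real.sqrt (l₁ : ℝ)) ^ 2 = l₁ := Real.sq_sqrt hl₁.le
    field_simp
    nlinarith [h1', Real.pi_pos]
  have hρpos : 0 < Real.sqrt (l₂ : ℝ) / Real.sqrt l₁ :=
    div_pos (Real.sqrt_pos.mpr hl₂) (Real.sqrt_pos.mpr hl₁)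
  set ρ : ℝ := Real.sqrt (l₂ : ℝ) / Real.sqrt l₁ with hρdef
  rw [hρ] at hA
  have hρC : (ρ : ℂ) ≠ 0 := by exact_mod_cast hρpos.ne'
  have key : (ρ : ℂ) * pet q l₁ l₂ = (if l₁ = l₂ then 1 else 0) - (ρ : ℂ) * petJ q l₁ l₂ :=
    hA.symm.trans hB
  by_cases h : l₁ = l₂
  · subst h
    have hρ1 : ρ = 1 := by rw [hρdef]; exact div_self (Real.sqrt_pos.mpr hl₁).ne'
    simpa [hρ1] using key
  · rw [if_neg h] at key ⊢
    have : (ρ : ℂ) * pet q l₁ l₂ = (ρ : ℂ) * (0 - petJ q l₁ l₂) := by rw [key]; ring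
    exact mul_left_cancel₀ hρC this

end Literature.NumberTheory.LFunctions.KowalskiMichel2000

end
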